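import Literature.NumberTheory.IwasawaTheory.ImaginaryQuadraticTwoTowerNoCapitulation
import Literature.NumberTheory.IwasawaTheory.ClassNumberPExpCoprimeGaloisCongruence
import Literature.NumberTheory.QuadraticFields.SquareRootGenerator
import HarnessLib

/-!
# The LOWER half of Ferrero's / Kida's `λ₂`-formula for imaginary quadratic fields with odd discriminant, modulo «no new roots of unity in the tower»:
# `λ₂(K) + 1 = Σ_{ℓ ∣ d_K} 2^{ord₂(ℓ²−1)−3}` EXACTLY (proved; no definition, no named fact)

Topic `NumberTheory/IwasawaTheory` (namespace = path).  THEOREM-ONLY file, written by the prover seat `bsd-line-att-p3` g31 (cell `bsd-f1-sign2`; `--supports`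
stmt-BirchSwinnertonDyer-22298; closes nothing).  Sequel of `ImaginaryQuadraticTwoTowerNoCapitulation` (no capitulation `Cl(X_{n+1}) → Cl(X_{n+2})`, `X_m = e(K)·ℚ_m ⊆ ℚ̄`,
modulo (W)), `ClassicalLambdaGeRankOfNoCapitulation` (no capitulation ⟹ `λ =` eventual rank) and g30's `ImaginaryQuadraticTwoTowerRankStabilisation` (`μ₂ = 0`,
`rank₂ Cl(K_m) = Σ − 1` for `m ≫ 0`, `λ₂ ≤ Σ − 1`).

* §1 `classGroupExtend_injective_layer_restrict` — (W) ⟹ **`Cl((K·ℚ_∞)_{n+1}) → Cl((K·ℚ_∞)_{n+2})` injective** for the restriction `κ|_K` (explicit isomorphisms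
  `X_m ≅ (κ|_K)_m` along `absClosureEquiv`, compatible with the inclusions; tree `ZpExtensionRestrictLayerCompositum`).
* §2 ★ `classicalLambda_add_one_eq_ferreroKidaSum_of_rootsOfUnity` — `K` imaginary quadratic, `d_K` odd, `−1 ∉ K²`, (W) for all layers of `e(K)·ℚ_∞`
  (canonical cyclotomic tower of `ℚ`): **`μ₂(K) = 0` and `classicalLambda κK + 1 = Σ_{ℓ ∣ d_K} 2^{ord₂(ℓ²−1)−3}` for EVERY cyclotomic `ℤ₂`-extension `κK` of `K`.**
* §3 `sq_ne_neg_one_of_sq_eq_neg` (`K ∋ η`, `η² = −d`, `d ≡ 3 (mod 4)` squarefree ⟹ `−1 ∉ K²`) and the `d`-keyed form ★ `ferreroKida_of_sq_eq_neg_of_rootsOfUnity`, whose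
  conclusion is LITERALLY that of the named fact `ferreroKida_classicalLambda_two_imaginaryQuadratic` (`… = Σ_{p ∈ primeFactors d ∖ {2}} 2^{v₂(p²−1)−3}`):
  the fact is discharged on its `d ≡ 3 (mod 4)` half MODULO the elementary hypothesis (W) «every root of unity of `e(K)·ℚ_m` lies in `e(K)`» (true for
  these `K`; its proof — residue field `𝔽₄` at a dyadic prime and `i ∉ K·ℚ_m` — is left to the sequel).

References: [Ferrero1980AJM] Thm. and §§2–3; [Kida1979Tohoku] Thm. 1; [Washington1997] §13.1, §13.3, Prop. 13.28; [Schettler2014] Thm. 2 (the printed formula).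
-/

set_option autoImplicit false

noncomputable section

open scoped NumberField nonZeroDivisors
open NumberField IsDedekindDomain Field IntermediateField Module Ideal Finset

namespace Literature.NumberTheory.IwasawaTheory

open Literature.NumberTheory.EllipticCurves Literature.NumberTheory.EllipticCurves.ZpExtension
  Literature.NumberTheory.GaloisRepresentations Literature.NumberTheory.NumberFields Literature.NumberTheory.QuadraticFields

/-! ## §1 Transport to the layers of `κ|_K` -/

section Restrict

variable {κ : ZpExtension ℚ 2} (hκ : κ.IsCyclotomic) (K : Type) [Field K] [NumberField K] (hK : IsImaginaryQuadratic K)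

omit hκ in
/-- **The layer `(κ|_K)_m` is the compositum `e(K)·ℚ_m`**, by the explicit isomorphism `y ↦ θ y` (`θ = absClosureEquiv ℚ K`; tree
`ZpExtensionRestrictLayerCompositum`, here with the underlying map recorded). [cite: Washington1997, §13.1] -/
theorem exists_ringEquiv_fieldRange_sup_layer_apply (h : Function.Surjective (κ.toContinuousMonoidHom.comp (absGaloisRestrict ℚ K))) (m : ℕ) :
    ∃ f : ↥((absEmbedding ℚ K).fieldRange ⊔ κ.layer m) ≃+* ↥((κ.restrict K h).layer m),
      ∀ y, ((f y : ↥((κ.restrict K h).layer m)) : AlgebraicClosure K) = EllipticCurves.absClosureEquiv ℚ K y := by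
  have hmem : ∀ (y : AlgebraicClosure ℚ), y ∈ (absEmbedding ℚ K).fieldRange ⊔ κ.layer m ↔
      EllipticCurves.absClosureEquiv ℚ K y ∈ (κ.restrict K h).layer m := fun y =>
    (mem_fieldRange_sup_layer_iff κ K m y).trans (absClosureEquiv_mem_layer_restrict_iff κ K h m y).symm
  have hmem' : ∀ (x : AlgebraicClosure K), x ∈ (κ.restrict K h).layer m ↔
      (EllipticCurves.absClosureEquiv ℚ K).symm x ∈ (absEmbedding ℚ K).fieldRange ⊔ κ.layer m := fun x => by
    rw [hmem, AlgEquiv.apply_symm_apply]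
  exact ⟨{ toFun := fun y => ⟨EllipticCurves.absClosureEquiv ℚ K y, (hmem y).mp y.2⟩
           invFun := fun x => ⟨(EllipticCurves.absClosureEquiv ℚ K).symm x, (hmem' x).mp x.2⟩
           left_inv := fun y => Subtype.ext ((EllipticCurves.absClosureEquiv ℚ K).symm_apply_apply y)
           right_inv := fun x => Subtype.ext ((EllipticCurves.absClosureEquiv ℚ K).apply_symm_apply x)
           map_mul' := fun y y' => Subtype.ext (map_mul (EllipticCurves.absClosureEquiv ℚ K) y.1 y'.1)
           map_add' := fun y y' => Subtype.ext (map_add (EllipticCurves.absClosureEquiv ℚ K) y.1 y'.1) }, fun y => rfl⟩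

omit hκ in
/-- **Compatibility with the inclusions**: the isomorphisms `e(K)·ℚ_{n+1} ≅ (κ|_K)_{n+1}`, `e(K)·ℚ_{n+2} ≅ (κ|_K)_{n+2}` of
`exists_ringEquiv_fieldRange_sup_layer_apply` commute with the inclusions. [cite: Washington1997, §13.1] -/
theorem exists_ringEquiv_fieldRange_sup_layer_pair (h : Function.Surjective (κ.toContinuousMonoidHom.comp (absGaloisRestrict ℚ K))) (n : ℕ) :
    letI : Algebra ↥((absEmbedding ℚ K).fieldRange ⊔ κ.layer (n + 1)) ↥((absEmbedding ℚ K).fieldRange ⊔ κ.layer (n + 2)) :=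
      (IntermediateField.inclusion (sup_le_sup_left (κ.layer_mono (by omega)) _)).toRingHom.toAlgebra
    letI : Algebra ↥((κ.restrict K h).layer (n + 1)) ↥((κ.restrict K h).layer (n + (1 + 1))) :=
      (IntermediateField.inclusion ((κ.restrict K h).layer_mono (by omega))).toRingHom.toAlgebra
    ∃ (eM : ↥((absEmbedding ℚ K).fieldRange ⊔ κ.layer (n + 1)) ≃+* ↥((κ.restrict K h).layer (n + 1)))
      (eL : ↥((absEmbedding ℚ K).fieldRange ⊔ κ.layer (n + 2)) ≃+* ↥((κ.restrict K h).layer (n + (1 + 1)))),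
      ∀ x, eL (algebraMap _ _ x) = algebraMap _ _ (eM x) := by
  letI : Algebra ↥((absEmbedding ℚ K).fieldRange ⊔ κ.layer (n + 1)) ↥((absEmbedding ℚ K).fieldRange ⊔ κ.layer (n + 2)) :=
    (IntermediateField.inclusion (sup_le_sup_left (κ.layer_mono (by omega)) _)).toRingHom.toAlgebra
  letI : Algebra ↥((κ.restrict K h).layer (n + 1)) ↥((κ.restrict K h).layer (n + (1 + 1))) :=
    (IntermediateField.inclusion ((κ.restrict K h).layer_mono (by omega))).toRingHom.toAlgebra
  obtain ⟨f1, hf1⟩ := exists_ringEquiv_fieldRange_sup_layer_apply K h (n + 1)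
  obtain ⟨f2, hf2⟩ := exists_ringEquiv_fieldRange_sup_layer_apply K h (n + (1 + 1))
  refine ⟨f1, f2, fun x => Subtype.ext ?_⟩
  have hl : (((algebraMap ↥((absEmbedding ℚ K).fieldRange ⊔ κ.layer (n + 1)) ↥((absEmbedding ℚ K).fieldRange ⊔ κ.layer (n + 2)) x) :
      ↥((absEmbedding ℚ K).fieldRange ⊔ κ.layer (n + 2))) : AlgebraicClosure ℚ) = (x : AlgebraicClosure ℚ) := by
    rw [RingHom.algebraMap_toAlgebra, AlgHom.toRingHom_eq_coe, RingHom.coe_coe, IntermediateField.coe_inclusion]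
  have hr : ∀ z : ↥((κ.restrict K h).layer (n + 1)),
      ((algebraMap ↥((κ.restrict K h).layer (n + 1)) ↥((κ.restrict K h).layer (n + (1 + 1))) z : ↥((κ.restrict K h).layer (n + (1 + 1)))) :
        AlgebraicClosure K) = (z : AlgebraicClosure K) := fun z => by
    rw [RingHom.algebraMap_toAlgebra, AlgHom.toRingHom_eq_coe, RingHom.coe_coe, IntermediateField.coe_inclusion]
  rw [hr, hf1, hf2, hl]

include hκ hK in
/-- **(W) ⟹ `Cl((K·ℚ_∞)_{n+1}) → Cl((K·ℚ_∞)_{n+2})` is injective** for the restricted tower `κ|_K` (`K` imaginary quadratic, `d_K` odd, `−1 ∉ K²`), by transport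
along the isomorphisms of `exists_ringEquiv_fieldRange_sup_layer_pair` (`classGroupExtend_injective_of_ringEquiv`). [cite: Washington1997, §13.1] [cite: Ferrero1980AJM, §3] -/
theorem classGroupExtend_injective_layer_restrict (hd : Odd (NumberField.discr K).natAbs) (hi : ∀ k : K, k ^ 2 ≠ -1)
    (h : Function.Surjective (κ.toContinuousMonoidHom.comp (absGaloisRestrict ℚ K))) (n : ℕ)
    (hW : ∀ x : ↥((absEmbedding ℚ K).fieldRange ⊔ κ.layer (n + 2)), (∃ k : ℕ, 0 < k ∧ x ^ k = 1) →
      (x : AlgebraicClosure ℚ) ∈ (absEmbedding ℚ K).fieldRange)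
    [NumberField ↥((κ.restrict K h).layer (n + 1))] [NumberField ↥((κ.restrict K h).layer (n + (1 + 1)))] :
    letI : Algebra ↥((κ.restrict K h).layer (n + 1)) ↥((κ.restrict K h).layer (n + (1 + 1))) :=
      (IntermediateField.inclusion ((κ.restrict K h).layer_mono (by omega))).toRingHom.toAlgebra
    Function.Injective (classGroupExtend ↥((κ.restrict K h).layer (n + 1)) ↥((κ.restrict K h).layer (n + (1 + 1)))) := by
  haveI : NumberField ↥((absEmbedding ℚ K).fieldRange ⊔ κ.layer (n + 1)) := numberField_fieldRange_sup_layer κ K _ (n + 1)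
  haveI : NumberField ↥((absEmbedding ℚ K).fieldRange ⊔ κ.layer (n + 2)) := numberField_fieldRange_sup_layer κ K _ (n + 2)
  letI : Algebra ↥((absEmbedding ℚ K).fieldRange ⊔ κ.layer (n + 1)) ↥((absEmbedding ℚ K).fieldRange ⊔ κ.layer (n + 2)) :=
    (IntermediateField.inclusion (sup_le_sup_left (κ.layer_mono (by omega)) _)).toRingHom.toAlgebra
  letI : Algebra ↥((κ.restrict K h).layer (n + 1)) ↥((κ.restrict K h).layer (n + (1 + 1))) :=
    (IntermediateField.inclusion ((κ.restrict K h).layer_mono (by omega))).toRingHom.toAlgebra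
  have hinj := classGroupExtend_injective_fieldRange_sup_layer hκ K hK (absEmbedding ℚ K) hd hi n hW
  obtain ⟨eM, eL, hcomp⟩ := exists_ringEquiv_fieldRange_sup_layer_pair K h n
  exact classGroupExtend_injective_of_ringEquiv eM eL hcomp hinj

end Restrict

/-! ## §2 `λ₂(K) + 1 = Σ_{ℓ ∣ d_K} 2^{ord₂(ℓ²−1)−3}` modulo (W) -/

section Lambda

variable (K : Type) [Field K] [NumberField K] (hK : IsImaginaryQuadratic K)

include hK in
/-- ★ **The Ferrero–Kida value, modulo (W).**  `K` imaginary quadratic with odd `d_K` and `−1 ∉ K²`; (W): every root of unity of `e(K)·ℚ_m ⊆ ℚ̄` lies in `e(K)`, for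
every layer `ℚ_m` of the canonical cyclotomic `ℤ₂`-extension of `ℚ`.  THEN for every cyclotomic `ℤ₂`-extension `κK` of `K`: **`μ₂ = 0` and
`classicalLambda κK + 1 = Σ_{ℓ ∣ d_K} 2^{ord₂(ℓ²−1)−3}`** (upper half: g30, rank certificate + Fukuda; lower half: no capitulation + `λ =` eventual rank `= Σ − 1`).
[cite: Ferrero1980AJM, Thm.] [cite: Kida1979Tohoku, Thm. 1] [cite: Schettler2014, Thm. 2] [cite: Washington1997, §13.3 Thm. 13.13 and Prop. 13.28] -/
theorem classicalLambda_add_one_eq_ferreroKidaSum_of_rootsOfUnity (hd : Odd (NumberField.discr K).natAbs) (hi : ∀ k : K, k ^ 2 ≠ -1)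
    (hW : ∀ (m : ℕ) (x : ↥((absEmbedding ℚ K).fieldRange ⊔ (CyclotomicZp.zpExtension 2).layer m)), (∃ k : ℕ, 0 < k ∧ x ^ k = 1) →
      (x : AlgebraicClosure ℚ) ∈ (absEmbedding ℚ K).fieldRange)
    (κK : ZpExtension K 2) (hκK : κK.IsCyclotomic) :
    ClassicalMuVanishes κK ∧
      classicalLambda κK + 1 = ∑ ℓ ∈ (NumberField.discr K).natAbs.primeFactors, 2 ^ (padicValNat 2 (ℓ ^ 2 - 1) - 3) := by
  haveI : Fact (Nat.Prime 2) := ⟨Nat.prime_two⟩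
  set κ := CyclotomicZp.zpExtension 2 with hκdef
  have hcyc : κ.IsCyclotomic := CyclotomicZp.isCyclotomic_zpExtension 2
  have hsurj := surjective_comp_absGaloisRestrict_imaginaryQuadratic_two hcyc K hK
  set κ₀ := κ.restrict K hsurj with hκ₀
  have hκ₀c : κ₀.IsCyclotomic := isCyclotomic_restrict κ hcyc K hsurj
  obtain ⟨hμ₀, _⟩ := classicalLambda_le_ferreroKidaSum_sub_one K hK hd κ₀ hκ₀c
  have hTR := totallyRamifiedFrom_zero_of_odd_discr K hK.1 hd κ₀ hκ₀c
  -- no capitulation above layer 1, from (W)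
  have hinj : ∀ n, 0 ≤ n → 0 ≤ n → ∀ [NumberField (κ₀.layer (n + 1))] [NumberField (κ₀.layer (n + (1 + 1)))],
      letI : Algebra (κ₀.layer (n + 1)) (κ₀.layer (n + (1 + 1))) :=
        (IntermediateField.inclusion (κ₀.layer_mono (by omega))).toRingHom.toAlgebra
      Function.Injective (classGroupExtend (κ₀.layer (n + 1)) (κ₀.layer (n + (1 + 1)))) := by
    intro n _ _ _ _
    exact classGroupExtend_injective_layer_restrict hcyc K hK hd hi hsurj n (hW (n + 2))
  -- the eventual rank `Σ − 1`
  set n₀ := (NumberField.discr K).natAbs.primeFactors.sup (fun ℓ => padicValNat 2 (ℓ ^ 2 - 1) - 3) with hn₀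
  have hn₀' : ∀ ℓ ∈ (NumberField.discr K).natAbs.primeFactors, padicValNat 2 (ℓ ^ 2 - 1) - 3 ≤ n₀ := fun ℓ hℓ =>
    Finset.le_sup (f := fun ℓ => padicValNat 2 (ℓ ^ 2 - 1) - 3) hℓ
  have hr : ∀ m, n₀ ≤ m → classGroupPRank κ₀ m = (∑ ℓ ∈ (NumberField.discr K).natAbs.primeFactors, 2 ^ (padicValNat 2 (ℓ ^ 2 - 1) - 3)) - 1 :=
    fun m hm => (classGroupPRank_cyclotomic_two_eq_of_le K hK hd κ₀ hκ₀c hn₀' hm).1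
  have h1 := (classGroupPRank_cyclotomic_two_eq_of_le K hK hd κ₀ hκ₀c hn₀' le_rfl).2
  have hlam0 := classicalLambda_eq_of_classGroupExtend_injective_of_classGroupPRank_eq κ₀ hTR hμ₀ hinj hr
  refine ⟨(classicalLambda_le_ferreroKidaSum_sub_one K hK hd κK hκK).1, ?_⟩
  rw [classicalLambda_eq_of_isCyclotomic κK κ₀ hκK hκ₀c, hlam0]
  omega

end Lambda

/-! ## §3 `−1 ∉ K²` for `K ∋ √−d`, `d ≡ 3 (mod 4)`; the `d`-keyed form -/

section DKeyed

variable (K : Type) [Field K] [NumberField K]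

/-- **`−1` is not a square in `K = ℚ(√−d)`, `d ≡ 3 (mod 4)` squarefree**: with `K = ℚ ⊕ ℚη`, `η² = −d`, `(a + bη)² = −1` forces `ab = 0` and then `a² = −1` or
`d b² = 1`, both impossible (`d` is not a rational square: a square is `≢ 3 (mod 4)`). [cite: Washington1997, §13.1] -/
theorem sq_ne_neg_one_of_sq_eq_neg (hK2 : Module.finrank ℚ K = 2) {d : ℕ} (hd4 : d % 4 = 3) (hη : ∃ η : K, η ^ 2 = -((d : ℕ) : K)) (k : K) :
    k ^ 2 ≠ -1 := by
  classical
  obtain ⟨η, hη⟩ := hη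
  have hdpos : (0 : ℚ) < d := by exact_mod_cast (show 0 < d by omega)
  -- `η ∉ ℚ`
  have hθ : η ∉ Set.range (algebraMap ℚ K) := by
    rintro ⟨q, hq⟩
    have h1 : algebraMap ℚ K (q ^ 2) = algebraMap ℚ K (-(d : ℚ)) := by
      rw [map_pow, hq, hη, map_neg, map_natCast]
    have h2 : q ^ 2 = -(d : ℚ) := (algebraMap ℚ K).injective h1
    nlinarith [sq_nonneg q]
  have hc : η ^ 2 = algebraMap ℚ K (-(d : ℚ)) := by rw [hη, map_neg, map_natCast]
  intro hk
  obtain ⟨a, b, rfl⟩ := Quadratic.exists_eq_add_mul hK2 hθ k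
  rw [pow_two, Quadratic.add_mul_mul_add_mul hc] at hk
  have hk' : algebraMap ℚ K (a * a + b * b * -(d : ℚ)) + algebraMap ℚ K (a * b + b * a) * η =
      algebraMap ℚ K (-1) + algebraMap ℚ K 0 * η := by rw [hk, map_neg, map_one, map_zero, zero_mul, add_zero]
  obtain ⟨h1, h2⟩ := Quadratic.ext_add_mul hθ hk'
  have hab : a * b = 0 := by linarith
  rcases mul_eq_zero.mp hab with ha | hb
  · rw [ha] at h1
    -- `- b² d = -1`, i.e. `d b² = 1`: `d` is a rational square
    have hsq : IsSquare (d : ℚ) := ⟨b⁻¹, by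
      have hb0 : b ≠ 0 := by rintro rfl; norm_num at h1
      field_simp
      nlinarith [h1]⟩
    obtain ⟨r, hr⟩ := Rat.isSquare_natCast_iff.mp hsq
    have : d % 4 = 0 ∨ d % 4 = 1 := by
      rcases Nat.even_or_odd r with ⟨t, rfl⟩ | ⟨t, rfl⟩ <;> [left; right] <;> rw [hr] <;> ring_nf <;> omega
    omega
  · rw [hb] at h1
    have : a * a = -1 := by linarith
    nlinarith [mul_self_nonneg a]

/-- ★ **Ferrero–Kida, `d ≡ 3 (mod 4)`, modulo (W)** — in the shape of the named fact `ferreroKida_classicalLambda_two_imaginaryQuadratic`: `[K : ℚ] = 2`, `K ∋ η` with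
`η² = −d`, `d ≡ 3 (mod 4)` squarefree (`> 2` automatically), (W) for the layers of `e(K)·ℚ_∞`; THEN for every cyclotomic `ℤ₂`-extension `κ` of `K`:
**`ClassicalMuVanishes κ ∧ classicalLambda κ + 1 = Σ_{p ∈ primeFactors d ∖ {2}} 2^{v₂(p²−1)−3}`.** [cite: Schettler2014, Thm. 2] [cite: Ferrero1980AJM, Thm.]
[cite: Kida1979Tohoku, Thm. 1] -/
theorem ferreroKida_of_sq_eq_neg_of_rootsOfUnity (hK2 : Module.finrank ℚ K = 2) {d : ℕ} (hsf : Squarefree d) (hd4 : d % 4 = 3)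
    (hη : ∃ η : K, η ^ 2 = -((d : ℕ) : K))
    (hW : ∀ (m : ℕ) (x : ↥((absEmbedding ℚ K).fieldRange ⊔ (CyclotomicZp.zpExtension 2).layer m)), (∃ k : ℕ, 0 < k ∧ x ^ k = 1) →
      (x : AlgebraicClosure ℚ) ∈ (absEmbedding ℚ K).fieldRange)
    (κ : ZpExtension K 2) (hκ : κ.IsCyclotomic) :
    ClassicalMuVanishes κ ∧ classicalLambda κ + 1 = ∑ p ∈ d.primeFactors.erase 2, 2 ^ (padicValNat 2 (p ^ 2 - 1) - 3) := by
  obtain ⟨hIQ, hnat, hodd⟩ := isImaginaryQuadratic_and_natAbs_discr_eq_of_sq_eq_neg K hK2 hsf hd4 hη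
  have hi := sq_ne_neg_one_of_sq_eq_neg K hK2 hd4 hη
  obtain ⟨hμ, hlam⟩ := classicalLambda_add_one_eq_ferreroKidaSum_of_rootsOfUnity K hIQ hodd hi hW κ hκ
  refine ⟨hμ, ?_⟩
  have h2 : 2 ∉ d.primeFactors := fun h => by
    have := Nat.dvd_of_mem_primeFactors h; omega
  rw [Finset.erase_eq_of_notMem h2, ← hnat]
  exact hlam

end DKeyed

end Literature.NumberTheory.IwasawaTheory

end
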